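import Mathlib
import HarnessLib
import Summits.NavierStokesRegularity.NavierStokesRegularity.Theorems.PoloidalWindowDoorLrcModEntireJetCertFast2
import Summits.NavierStokesRegularity.NavierStokesRegularity.Theorems.PoloidalWindowDoorLrcModEntireTHCertFast

/-!
# Route `PoloidalWindowDoor`, item `LrcModEntire` (stmt-NavierStokesRegularity-20428) — `stub_localTHEmpty` from v3 (merge-sort) certificates

Cell ns-regularity-ideate, seat ns-poloidal-K2-p3 gen 7 (lead of item 20428; `--supports stmt-NavierStokesRegularity-20428`).
One-shot and chunked closers for the v3 checker `…JetCertFast2.checkTreeS` (fastest of the three interpreters; same `LocalDatum`, same (TH) wiring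
`…THCertFast.thLocalDatum`): `stub_localTHEmpty_of_checkTreeS` (registered stub VERBATIM) and `false_of_checkTreeS_extended` (final step after
`localDatum_extendS` chunks).  WHAT THIS IS NOT: not a claim about Navier–Stokes and not a certificate. [folklore]
-/

noncomputable section

-- the summit and its single sub-problem share the name (CONVENTIONS §1), as in every Theorems file
set_option linter.dupNamespace false

namespace Summit.NavierStokesRegularity.NavierStokesRegularity.Theorems.PoloidalWindowDoorLrcModEntireTHCertFast2

open _root_.Topology _root_.Filter Set Function
open scoped InnerProductSpace Laplacian
open Literature.Analysis.ValidatedNumerics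
open Summit.NavierStokesRegularity.NavierStokesRegularity.Theorems.PoloidalWindowDoorLrcModEntireJetCertTree
open Summit.NavierStokesRegularity.NavierStokesRegularity.Theorems.PoloidalWindowDoorLrcModEntireJetCertFast2
open Summit.NavierStokesRegularity.NavierStokesRegularity.Theorems.PoloidalWindowDoorLrcModEntireTHCertLetters
open Summit.NavierStokesRegularity.NavierStokesRegularity.Theorems.PoloidalWindowDoorLrcModEntireTHCert
open Summit.NavierStokesRegularity.NavierStokesRegularity.Theorems.PoloidalWindowDoorLrcModEntireTHCertFast

/-- **The generic final step of a CHUNKED v3 certificate.** [folklore] -/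
theorem false_of_checkTreeS_extended (L : List THLetter) (Ts : List QMvPoly) (t : CertTree)
    (ht : checkTreeS L.length (tableOf L) (maskOf L) (thHyps L ++ Ts) (thPins L) t = true)
    (hdat : LocalDatum (E := ℝ × EuclideanSpace ℝ (Fin 3)) L.length (tableOf L) (maskOf L) dirVec (thHyps L ++ Ts) (thPins L)) :
    False :=
  not_localDatum_of_checkTreeS t _ _ ht hdat

/-- **`stub_localTHEmpty` from a tree checked by the v3 checker**, VERBATIM the registered stub. [folklore] -/
theorem stub_localTHEmpty_of_checkTreeS (L : List THLetter) (hL : lettersOK L = true) (t : CertTree)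
    (ht : checkTreeS L.length (tableOf L) (maskOf L) (thHyps L) (thPins L) t = true) :
    ∀ (u : ℝ → EuclideanSpace ℝ (Fin 3) → EuclideanSpace ℝ (Fin 3)) (μ A : ℝ → ℝ → ℝ)
      (U : Set (ℝ × EuclideanSpace ℝ (Fin 3))) (p₀ : ℝ × EuclideanSpace ℝ (Fin 3)),
      IsOpen U → p₀ ∈ U →
      AnalyticOnNhd ℝ (Function.uncurry u) U →
      (∀ p ∈ U, AnalyticAt ℝ (Function.uncurry μ) (p.1, p.2 2)) →
      (∀ p ∈ U, AnalyticAt ℝ (Function.uncurry A) (p.1, p.2 2)) →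
      (∀ p ∈ U, fderiv ℝ (u p.1) p.2 (EuclideanSpace.single 0 1) 1 = fderiv ℝ (u p.1) p.2 (EuclideanSpace.single 1 1) 0) →
      (∀ p ∈ U, fderiv ℝ (u p.1) p.2 (EuclideanSpace.single 0 1) 0 + fderiv ℝ (u p.1) p.2 (EuclideanSpace.single 1 1) 1 +
        fderiv ℝ (u p.1) p.2 (EuclideanSpace.single 2 1) 2 = 0) →
      (∀ p ∈ U, ∀ b : Fin 3, b ≠ 2 →
        fderiv ℝ (u p.1) p.2 (EuclideanSpace.single 2 1) b =
          μ p.1 (p.2 2) * fderiv ℝ (u p.1) p.2 (EuclideanSpace.single b 1) 2) →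
      (∀ p ∈ U,
        (1 - μ p.1 (p.2 2)) *
            (deriv (fun s => u s p.2 2) p.1 + fderiv ℝ (fun y => u p.1 y 2) p.2 (u p.1 p.2)
              - Δ (fun y => u p.1 y 2) p.2) =
          A p.1 (p.2 2) + (deriv (fun s => μ s (p.2 2)) p.1 - deriv (deriv (μ p.1)) (p.2 2)) * u p.1 p.2 2
            + deriv (μ p.1) (p.2 2) / 2 * u p.1 p.2 2 ^ 2
            - 2 * deriv (μ p.1) (p.2 2) * fderiv ℝ (u p.1) p.2 (EuclideanSpace.single 2 1) 2) →
      fderiv ℝ (fun y => fderiv ℝ (u p₀.1) y (EuclideanSpace.single 2 1) 2) p₀.2 (EuclideanSpace.single 0 1) *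
            fderiv ℝ (u p₀.1) p₀.2 (EuclideanSpace.single 1 1) 2 -
          fderiv ℝ (fun y => fderiv ℝ (u p₀.1) y (EuclideanSpace.single 2 1) 2) p₀.2 (EuclideanSpace.single 1 1) *
            fderiv ℝ (u p₀.1) p₀.2 (EuclideanSpace.single 0 1) 2 ≠ 0 →
      μ p₀.1 (p₀.2 2) ≠ 0 → μ p₀.1 (p₀.2 2) ≠ 1 → deriv (μ p₀.1) (p₀.2 2) ≠ 0 → False := by
  intro u μ A U p₀ hU hp₀ hu hμ hA hpol hdiv hsh hE htw hm0 hm1 hmz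
  exact not_localDatum_of_checkTreeS (v := dirVec) t (thHyps L) (thPins L) ht
    (thLocalDatum L hL hU hp₀ hu hμ hA hpol hdiv hsh hE htw hm0 hm1 hmz)

end Summit.NavierStokesRegularity.NavierStokesRegularity.Theorems.PoloidalWindowDoorLrcModEntireTHCertFast2

end
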